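import Literature.AnabelianGeometry.EtaleTheta.Discharge.Sec2InnerInducesOnTheta
import Literature.AnabelianGeometry.EtaleTheta.Discharge.Sec2Cor28iEndKnitChiCusp
import Literature.AnabelianGeometry.EtaleTheta.Discharge.Sec2OuterPairsFireChiModel
import HarnessLib

/-!
# [EtTh] Cor 2.8 (i) at the cusped inversion model `χ′`, inner case, I: `Π^tp_Ÿ ⊴ Π^tp_C` at the section-route cover (the binders
# `hY`/`hYuu` of abc-iut-L2-t2's `Cor28_i` are THEOREMS for every inner `γ_y`) and the F-0643 HEAD FORM `γ_y` induces `act y` there (proof-only)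

S. Mochizuki, *The étale theta function and its Frobenioid-theoretic manifestations* [EtTh], Publ. RIMS **45** (2009)
(refereed), §2, Cor 2.8 (i) PRIMS PDF p.42 («The isomorphism `γ` preserves the property that `η̲̈^{Θ,l·ℤ×μ₂}` (respectively,
`η̈^{Θ,ℤ×μ₂}`; `η̲̈^{Θ,l·ℤ×μ₂}`; `η̈^{Θ,l·ℤ×μ₂}`) be of standard type — a property that determines this collection of classes up
to multiplication by a root of unity of order `l` (respectively, 1; `l`; 1)»; proof p.42: «First, let us recall the
characteristic nature of the various coverings involved [cf. Propositions 2.4, 2.6]. Now assertion (i) follows immediately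
from Theorem 1.10, (i), and the definitions»), §2 p.40 («the covering `Ÿ^log → C^log`»), Thm 1.6 (i) p.24 (bib key
`MochizukiEtTh2009`; own render `paper:doi-10-2977-prims-1234361159` p0042/p0040/p0024).

PROOF-ONLY companion (0 `def`, 0 `instance`, 0 notation, no new `Prop`; cell abc-iut, block F, seat abc-iut-f-193 gen 14;
row **F-0643** `ThetaOrbitData.InducesOnTheta`, node EtTh:Cor2.8(i); abc-iut-L2-lead R1375 item (3) «head-form instance at the
χ′ cover ∀ y»; sequel of this seat's `InducesOnThetaInstances` (gen 13); every input BY NAME, nothing restated).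
abc-iut-f-151's END-KNIT `SettingModel.cor28_i_innerAutTop_endKnit_inversionModelχ'` proves the body of `Cor28_i` for every INNER
`γ_y`, `y ∈ Π^tp_C`, at abc-iut-L2-d3's section-route cover `temperedCoverDataOfHuuOfSection` / `orbitEmbeddingOfHuuOfSection` over
abc-iut-w5-d140's `MuTwoSetting.inversionModelχ′`, modulo `Cor28_i`'s OWN binders: the coefficient automorphism `Γ_Θ` with
`InducesOnTheta γ_y Γ_Θ`, `hYmap : γ_y(Π^tp_Ÿ) = Π^tp_Ÿ`, `hYuu : γ_y(Π^tp_Ÿ ∩ Π^tp_{X̲̲}) = Π^tp_Ÿ ∩ Π^tp_{X̲̲}`, and the clause-wise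
stability premises.  THIS FILE shows that at that cover the first three are THEOREMS for EVERY `y`:
* §1 (interface, any `T`) `TemperedCoverData.map_PiYddtp_inf_tp_PiXuu_eq(_of_tower)` — `hYuu` follows from `hYmap` and the
  `Π^tp_{X̲̲}`-entry of the tower premise of clause C2 (`Γ` is injective);
* §2 `SettingModel.conjX_mem_GtpYdd_inversionModelχ'` — for EVERY `x ∈ Π^tp_C = Π^tp_X ⋊_ι ℤ/2` of `χ′`, `e.conjX x` preserves
  `Π^tp_Ÿ` (`Π^tp_Ÿ ⊴ Π^tp_X` by `Compat` + abc-iut-L2-d1's `thm16i_twistedInversion_modelχ` through abc-iut-w6-d083's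
  `invActionχ_mem_GtpYdd`: the cusped twin of abc-iut-w6-d083's `conjX_mem_GtpYdd_inversionModelχ`); hence
  **`piYddtp_normal_ofHuuOfSection`: `Π^tp_Ÿ ⊴ Π^tp_C`** at the section-route cover (a property of this semi-synthetic cover;
  print, p.40, only records that «the covering `Ÿ^log → C^log` factors naturally through `Ẋ`») and
  **`map_PiYddtp_innerAutTop_ofHuuOfSection`** = the binder `hYmap` for EVERY `y`;
* §3 **F-0643 head form at the χ′ cover**: `inducesOnTheta_innerAutTop_ofHuuOfSection` — for EVERY `y ∈ Π^tp_C`, `γ_y` INDUCES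
  `act y` on `Δ_Θ` of `ofEmbedding (orbitEmbeddingOfHuuOfSection …)` (the term of this seat's `ofEmbedding_inducesOnTheta_innerAutTop`, p515906,
  over abc-iut-L2-t2's `map_innerAutTop_eq_of_normal`), and `existsUnique_…` (exactly one `Γ_Θ`, by abc-iut-L2-t2's
  `inducesOnTheta_innerAutTop_eq_act`);
SEQUEL (`Discharge/Sec2Cor28iEndKnitChiCuspOfInduces.lean`, this seat): abc-iut-f-151's END-KNIT and its two ∃-forms at THE cover of
record RE-KEYED with `hYmap`/`hYuu` DISCHARGED by §1–§2 (residual for inner `γ_y` at χ′ = `Γ_Θ`/`InducesOnTheta` — inhabited exactly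
once by §3 — and the clauses' own stability premises).  The outer binder `hYα : ∀ g ∈ Π^tp_Ÿ, e.conjX y g ∈ Π^tp_Ÿ` of abc-iut-w6-d050's
χ′ junction `exists_mem_dotXuu_pC5_inversionModelχ'` / `cor28_iii_outer_endKnit_inversionModelχ'` (its `hYmap`) is §2 BY NAME as well.
WHAT IS NOT CLAIMED: non-inner `Γ` (abc-iut-L2-t1's `Sec2Cor28iCoverOfRecordThetaRigidityAlone`, modulo unit-free theta
rigidity); the universal closure of `InducesOnTheta` / `Cor28_i` over the interface is refuted (abc-iut-w4-d051) — instance forms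
only.  HONEST FRAMING: semi-synthetic model = consistency / non-vacuity evidence for the TYPED interface; [EtTh] is refereed and
nothing of it is asserted beyond the displayed statements; no side is taken on [IUTchIII] Cor 3.12; typed ≠ proved; instantiated ≠
endorsed; nothing here bears on abc itself.
-/

noncomputable section

namespace Literature.AnabelianGeometry.EtaleTheta

open Literature.AnabelianGeometry.SemiGraphs ThetaCovers Literature.IUT.HodgeArakelov
open _root_.Topology _root_.Function
open ThetaSetting.EtaleThetaData.DoubleUnderline.OrbitEmbedding (symm_toTheta_eq)

/-! ## §1. Interface: `hYuu` from `hYmap` and the `Π^tp_{X̲̲}`-stability (any `T`, any `Γ`) -/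

namespace ThetaCovers.TemperedCoverData

universe u

/-- **`γ(Π^tp_Ÿ ∩ Π^tp_{X̲̲}) = Π^tp_Ÿ ∩ Π^tp_{X̲̲}` from `γ(Π^tp_Ÿ) = Π^tp_Ÿ` and `γ(Π^tp_{X̲̲}) = Π^tp_{X̲̲}`** (`γ` injective) —
the binder `hYuu` of `Cor28_i`/`Cor28_iii` is not independent data. [cite: MochizukiEtTh2009, Cor 2.8(i) p.42] -/
theorem map_PiYddtp_inf_tp_PiXuu_eq {l : ℕ} (T : TemperedCoverData.{u} l) (Γ : T.Gtp ≃ₜ* T.Gtp)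
    (hYmap : T.PiYddtp.map Γ.toMulEquiv.toMonoidHom = T.PiYddtp)
    (hXuu : (T.tp T.PiXuu).map Γ.toMulEquiv.toMonoidHom = T.tp T.PiXuu) :
    (T.PiYddtp ⊓ T.tp T.PiXuu).map Γ.toMulEquiv.toMonoidHom = T.PiYddtp ⊓ T.tp T.PiXuu := by
  rw [Subgroup.map_inf _ _ _ (fun a b h => Γ.toMulEquiv.injective h), hYmap, hXuu]

/-- **`hYuu` from the tower premise of clause C2**: `Π^tp_{X̲̲}` and `Π^tp_Ÿ` are the first and last entries of `T.tower`.
[cite: MochizukiEtTh2009, Prop 2.4 p.38] -/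
theorem map_PiYddtp_inf_tp_PiXuu_eq_of_tower {l : ℕ} (T : TemperedCoverData.{u} l) (Γ : T.Gtp ≃ₜ* T.Gtp)
    (htw : ∀ S ∈ T.tower, S.map Γ.toMulEquiv.toMonoidHom = S) :
    (T.PiYddtp ⊓ T.tp T.PiXuu).map Γ.toMulEquiv.toMonoidHom = T.PiYddtp ⊓ T.tp T.PiXuu :=
  T.map_PiYddtp_inf_tp_PiXuu_eq Γ (htw _ (by simp [TemperedCoverData.tower])) (htw _ (by simp [TemperedCoverData.tower]))

end ThetaCovers.TemperedCoverData

namespace SettingModel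

variable (p : ℕ) [Fact p.Prime]

/-! ## §2. `Π^tp_Ÿ` is stable under EVERY `x ∈ Π^tp_C` of `χ′`; `Π^tp_Ÿ ⊴ Π^tp_C` at the section-route cover -/

/-- **`e.conjX x` preserves `Π^tp_Ÿ` for every `x ∈ Π^tp_C = Π^tp_X ⋊_ι ℤ/2` of the CUSPED inversion model `χ′`** (every
C-level datum `e`): `e.conjX x = conj_{x₁} ∘ φ_{x₂}` (abc-iut-w6-d083's `eq_conj_invActionχ_of_inclInvχ`), `φ_z(Π^tp_Ÿ) ⊆ Π^tp_Ÿ`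
(`invActionχ_mem_GtpYdd`, [EtTh] Thm 1.6 (i) at the model) and `Π^tp_Ÿ ⊴ Π^tp_X` (`Compat`); `modelχ′` has the same `Π^tp_X`,
`Π^tp_Ÿ` as `modelχ`. The cusped twin of `conjX_mem_GtpYdd_inversionModelχ`. [cite: MochizukiEtTh2009, Thm 1.6 (i) p.24] -/
theorem conjX_mem_GtpYdd_inversionModelχ' (e : (MuTwoSetting.inversionModelχ' p).CLevelData) (x : PiCInvχ p) :
    ∀ g, g ∈ (MuTwoSetting.inversionModelχ' p).toThetaSetting.GtpYdd →
      e.conjX x g ∈ (MuTwoSetting.inversionModelχ' p).toThetaSetting.GtpYdd := by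
  haveI := (MuTwoSetting.inversionModelχ'_compat p).GtpYdd_normal
  intro g hg
  rw [eq_conj_invActionχ_of_inclInvχ p x (e.conjX x) (fun g => e.inclX_conjX x g) g]
  exact this.conj_mem _
    (show invActionχ p x.right g ∈ (MuTwoSetting.inversionModelχ' p).toThetaSetting.GtpYdd from
      invActionχ_mem_GtpYdd x.right (show g ∈ (ThetaSetting.modelχ p).GtpYdd from hg)) _

section Normality

variable {PC : Type} [Group PC] [TopologicalSpace PC] [IsTopologicalGroup PC] [T2Space PC]
variable (e : (MuTwoSetting.inversionModelχ' p).CLevelData)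
  (ιC : (MuTwoSetting.inversionModelχ' p).GtpC →ₜ* PC) (hιC : IsProfiniteCompletion ιC)
  (hinj : Function.Injective ιC) (op : (MuTwoSetting.inversionModelχ' p).toThetaSetting.OncePuncturedData)
  {l : ℕ} (hodd : Odd l)
  (s : ↥(MuTwoSetting.inversionModelχ' p).GK →* (MuTwoSetting.inversionModelχ' p).PiTemp)
  (hsa : ∀ σ, (MuTwoSetting.inversionModelχ' p).aug (s σ) = (σ : GQp p))
  (hsZ : ∀ σ, (MuTwoSetting.inversionModelχ' p).toZ (s σ) = 1)
  (hιell : ∀ c ∈ (e.piCDataOf ιC hιC).augGK.ker, c ∉ (e.piCDataOf ιC hιC).PiX →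
    ∀ d ∈ (e.piCDataOf ιC hιC).PiX ⊓ (e.piCDataOf ιC hιC).augGK.ker,
      c * d * c⁻¹ * d ∈ (e.piCDataOf ιC hιC).barTheta l)
  (hN : (((MuTwoSetting.inversionModelχ' p).GtpXu l).map (MuTwoSetting.inversionModelχ' p).inclX).Normal)
  (hY : ((MuTwoSetting.inversionModelχ' p).GtpY.map (MuTwoSetting.inversionModelχ' p).inclX).Normal)
  {E : (MuTwoSetting.inversionModelχ' p).toThetaSetting.EtaleThetaData}
  (C : E.DoubleUnderline l) (hK : (MuTwoSetting.inversionModelχ' p).barKerTp l ≤ C.Huu) (hsH : ∀ σ, s σ ∈ C.Huu)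
  {g : (MuTwoSetting.inversionModelχ' p).GtpC} (hgX : g ∉ (MuTwoSetting.inversionModelχ' p).inclX.range)
  (hι : C.IotaStable (e.conjX g))

/-- **`Π^tp_Ÿ ⊴ Π^tp_C` at abc-iut-L2-d3's section-route cover over `χ′`** (`T.PiYddtp = inclX(Π^tp_Ÿ)`, `T.Π^tp_C = Π^tp_X ⋊_ι ℤ/2`) —
a property of this semi-synthetic cover (print, p.40: «the covering `Ÿ^log → C^log` factors naturally through `Ẋ`»; nothing of
print is asserted). [cite: MochizukiEtTh2009, §2 p.40] -/
theorem piYddtp_normal_ofHuuOfSection :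
    (e.temperedCoverDataOfHuuOfSection ιC hιC hinj op hodd s hsa hsZ hιell hN hY C hK hsH hgX hι).PiYddtp.Normal := by
  refine ⟨fun n hn y => ?_⟩
  have hn' : n ∈ (MuTwoSetting.inversionModelχ' p).toThetaSetting.GtpYdd.map (MuTwoSetting.inversionModelχ' p).inclX := hn
  obtain ⟨k, hk, rfl⟩ := Subgroup.mem_map.1 hn'
  exact Subgroup.mem_map.2 ⟨e.conjX y k, conjX_mem_GtpYdd_inversionModelχ' p e y k hk, e.inclX_conjX y k⟩

/-- **The binder `hYmap` of `Cor28_i`/`Cor28_iii` for EVERY inner `γ_y`, `y ∈ Π^tp_C`**, at the section-route cover over `χ′`: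
`γ_y(Π^tp_Ÿ) = Π^tp_Ÿ`. [cite: MochizukiEtTh2009, Cor 2.8(i) p.42] -/
theorem map_PiYddtp_innerAutTop_ofHuuOfSection
    (y : (e.temperedCoverDataOfHuuOfSection ιC hιC hinj op hodd s hsa hsZ hιell hN hY C hK hsH hgX hι).Gtp) :
    (e.temperedCoverDataOfHuuOfSection ιC hιC hinj op hodd s hsa hsZ hιell hN hY C hK hsH hgX hι).PiYddtp.map
        (ThetaOrbitData.innerAutTop y).toMulEquiv.toMonoidHom =
      (e.temperedCoverDataOfHuuOfSection ιC hιC hinj op hodd s hsa hsZ hιell hN hY C hK hsH hgX hι).PiYddtp := by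
  haveI := piYddtp_normal_ofHuuOfSection p e ιC hιC hinj op hodd s hsa hsZ hιell hN hY C hK hsH hgX hι
  exact ThetaOrbitData.map_innerAutTop_eq_of_normal _ y

/-- **… and the binder `hYuu` under the `Π^tp_{X̲̲}`-stability of clause C2** (`γ_y(Π^tp_{X̲̲}) = Π^tp_{X̲̲}`), at the same cover.
[cite: MochizukiEtTh2009, Cor 2.8(i) p.42] -/
theorem map_PiYddtp_inf_tp_PiXuu_innerAutTop_ofHuuOfSection
    (y : (e.temperedCoverDataOfHuuOfSection ιC hιC hinj op hodd s hsa hsZ hιell hN hY C hK hsH hgX hι).Gtp)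
    (hXuu : ((e.temperedCoverDataOfHuuOfSection ιC hιC hinj op hodd s hsa hsZ hιell hN hY C hK hsH hgX hι).tp
          (e.temperedCoverDataOfHuuOfSection ιC hιC hinj op hodd s hsa hsZ hιell hN hY C hK hsH hgX hι).PiXuu).map
        (ThetaOrbitData.innerAutTop y).toMulEquiv.toMonoidHom =
      (e.temperedCoverDataOfHuuOfSection ιC hιC hinj op hodd s hsa hsZ hιell hN hY C hK hsH hgX hι).tp
        (e.temperedCoverDataOfHuuOfSection ιC hιC hinj op hodd s hsa hsZ hιell hN hY C hK hsH hgX hι).PiXuu) :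
    ((e.temperedCoverDataOfHuuOfSection ιC hιC hinj op hodd s hsa hsZ hιell hN hY C hK hsH hgX hι).PiYddtp ⊓
        (e.temperedCoverDataOfHuuOfSection ιC hιC hinj op hodd s hsa hsZ hιell hN hY C hK hsH hgX hι).tp
          (e.temperedCoverDataOfHuuOfSection ιC hιC hinj op hodd s hsa hsZ hιell hN hY C hK hsH hgX hι).PiXuu).map
        (ThetaOrbitData.innerAutTop y).toMulEquiv.toMonoidHom =
      (e.temperedCoverDataOfHuuOfSection ιC hιC hinj op hodd s hsa hsZ hιell hN hY C hK hsH hgX hι).PiYddtp ⊓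
        (e.temperedCoverDataOfHuuOfSection ιC hιC hinj op hodd s hsa hsZ hιell hN hY C hK hsH hgX hι).tp
          (e.temperedCoverDataOfHuuOfSection ιC hιC hinj op hodd s hsa hsZ hιell hN hY C hK hsH hgX hι).PiXuu :=
  ThetaCovers.TemperedCoverData.map_PiYddtp_inf_tp_PiXuu_eq _ _
    (map_PiYddtp_innerAutTop_ofHuuOfSection p e ιC hιC hinj op hodd s hsa hsZ hιell hN hY C hK hsH hgX hι y) hXuu

/-! ## §3. F-0643 HEAD FORM at the χ′ cover: `γ_y` induces `act y`, for EVERY `y ∈ Π^tp_C` -/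

/-- **F-0643, instance form at the χ′ cover** (abc-iut-L2-lead R1375 (3)): for EVERY `y ∈ Π^tp_C` of the section-route cover
over `χ′` and every pair of slots `(τ, τ′)`, the inner automorphism `γ_y` INDUCES the conjugation action `act y` on the cyclotome
`Δ_Θ` of abc-iut-L2-t2's `ofEmbedding (orbitEmbeddingOfHuuOfSection …)` — the instance of this seat's generic
`ofEmbedding_inducesOnTheta_innerAutTop` (p515906) at this cover; 0 hypotheses beyond the cover's data. [cite: MochizukiEtTh2009, Cor 2.8(i) p.42] -/
theorem inducesOnTheta_innerAutTop_ofHuuOfSection (τ τ' : ThetaSetting.NonCuspidalPoint E.toKummerData)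
    (y : (e.temperedCoverDataOfHuuOfSection ιC hιC hinj op hodd s hsa hsZ hιell hN hY C hK hsH hgX hι).Gtp) :
    (ThetaOrbitData.ofEmbedding (e.orbitEmbeddingOfHuuOfSection ιC hιC hinj op hodd s hsa hsZ hιell hN hY C hK hsH hgX hι τ τ')
        (MuTwoSetting.inversionModelχ'_compat p) (ThetaSetting.modelχ'_sec2Hyps p)).InducesOnTheta
      (ThetaOrbitData.innerAutTop y)
      (MulEquiv.mk'
        ⟨(ThetaOrbitData.ofEmbedding
            (e.orbitEmbeddingOfHuuOfSection ιC hιC hinj op hodd s hsa hsZ hιell hN hY C hK hsH hgX hι τ τ')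
            (MuTwoSetting.inversionModelχ'_compat p) (ThetaSetting.modelχ'_sec2Hyps p)).act y,
          (ThetaOrbitData.ofEmbedding
            (e.orbitEmbeddingOfHuuOfSection ιC hιC hinj op hodd s hsa hsZ hιell hN hY C hK hsH hgX hι τ τ')
            (MuTwoSetting.inversionModelχ'_compat p) (ThetaSetting.modelχ'_sec2Hyps p)).act y⁻¹,
          (ThetaOrbitData.ofEmbedding
            (e.orbitEmbeddingOfHuuOfSection ιC hιC hinj op hodd s hsa hsZ hιell hN hY C hK hsH hgX hι τ τ')
            (MuTwoSetting.inversionModelχ'_compat p) (ThetaSetting.modelχ'_sec2Hyps p)).act_inv_act y,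
          (ThetaOrbitData.ofEmbedding
            (e.orbitEmbeddingOfHuuOfSection ιC hιC hinj op hodd s hsa hsZ hιell hN hY C hK hsH hgX hι τ τ')
            (MuTwoSetting.inversionModelχ'_compat p) (ThetaSetting.modelχ'_sec2Hyps p)).act_act_inv y⟩
        (map_mul
          ((ThetaOrbitData.ofEmbedding
            (e.orbitEmbeddingOfHuuOfSection ιC hιC hinj op hodd s hsa hsZ hιell hN hY C hK hsH hgX hι τ τ')
            (MuTwoSetting.inversionModelχ'_compat p) (ThetaSetting.modelχ'_sec2Hyps p)).act y))) := by
  -- the term of this seat's `ThetaOrbitData.ofEmbedding_inducesOnTheta_innerAutTop` (`InducesOnThetaInstances`, p515906), spelled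
  -- out over abc-iut-L2-t2's `map_innerAutTop_eq_of_normal` so that this file does not depend on that module's build state
  haveI := (ThetaOrbitData.ofEmbedding
    (e.orbitEmbeddingOfHuuOfSection ιC hιC hinj op hodd s hsa hsZ hιell hN hY C hK hsH hgX hι τ τ')
    (MuTwoSetting.inversionModelχ'_compat p) (ThetaSetting.modelχ'_sec2Hyps p)).top_normal
  exact ⟨ThetaOrbitData.map_innerAutTop_eq_of_normal _ y, fun _ => rfl⟩

/-- **Exactly one `Γ_Θ` is induced by `γ_y`** at the χ′ cover, for every `y ∈ Π^tp_C`. [cite: MochizukiEtTh2009, Cor 2.8(i) p.42] -/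
theorem existsUnique_inducesOnTheta_innerAutTop_ofHuuOfSection (τ τ' : ThetaSetting.NonCuspidalPoint E.toKummerData)
    (y : (e.temperedCoverDataOfHuuOfSection ιC hιC hinj op hodd s hsa hsZ hιell hN hY C hK hsH hgX hι).Gtp) :
    ∃! ΓΘ : (ThetaOrbitData.ofEmbedding
          (e.orbitEmbeddingOfHuuOfSection ιC hιC hinj op hodd s hsa hsZ hιell hN hY C hK hsH hgX hι τ τ')
          (MuTwoSetting.inversionModelχ'_compat p) (ThetaSetting.modelχ'_sec2Hyps p)).DeltaTheta ≃*
        (ThetaOrbitData.ofEmbedding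
          (e.orbitEmbeddingOfHuuOfSection ιC hιC hinj op hodd s hsa hsZ hιell hN hY C hK hsH hgX hι τ τ')
          (MuTwoSetting.inversionModelχ'_compat p) (ThetaSetting.modelχ'_sec2Hyps p)).DeltaTheta,
      (ThetaOrbitData.ofEmbedding
          (e.orbitEmbeddingOfHuuOfSection ιC hιC hinj op hodd s hsa hsZ hιell hN hY C hK hsH hgX hι τ τ')
          (MuTwoSetting.inversionModelχ'_compat p) (ThetaSetting.modelχ'_sec2Hyps p)).InducesOnTheta
        (ThetaOrbitData.innerAutTop y) ΓΘ :=
  ⟨_, inducesOnTheta_innerAutTop_ofHuuOfSection p e ιC hιC hinj op hodd s hsa hsZ hιell hN hY C hK hsH hgX hι τ τ' y,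
    fun _ h => MulEquiv.ext fun a => ThetaOrbitData.inducesOnTheta_innerAutTop_eq_act _ h a⟩

end Normality

end SettingModel

end Literature.AnabelianGeometry.EtaleTheta

end
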